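import Summits.CriticalPhenomena.PercolationContinuityZ3.Theorems.PercNearOneGluingNoHeavyLowerTailAntitheticPendant
import Summits.CriticalPhenomena.PercolationContinuityZ3.Theorems.PercNearOneGluingNoHeavyLowerTailAntitheticDegTwoClusters
import HarnessLib

/-!
# `NoHeavyLowerTail` (stmt-CriticalPhenomena-4575) — antithetic cluster pairs: the PENDANT REDUCTION of TERM II (PR1 of HOME/THEOREM-Theta.md,
# prim-hp-2 gen 61)

Support file (`--supports stmt-CriticalPhenomena-4575`, hull-port prover `prim-hp-2`, gen 61).  No definitions, no named facts, no sorries;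
standard axioms.  VERTEX version; notation of …AntitheticTermOne / …AntitheticPendant: colourings `T ⊆ Sym2 V`, edge set `E`, source `s`,
`X T = openCluster (T ∩ E) s`, `Y T = openCluster (Tᶜ ∩ E) s`; a pendant pair `Py` attached at a leaf `y` meeting only loops of `E`.

TERM II of the deg-2 elimination at `x` (neighbours `y, z`; HOME/THEOREM-OneSided.md) over the edge set `E ∪ {Py}` is
`TII(y,z; h) = Σ_{T : y ∈ X⁺ T, z ∉ Y⁺ T} h₁(X⁺ T ∪ {x}) (Y⁺ T) · h₂(…)` (`X⁺, Y⁺` the clusters for `E ∪ {Py}`).  If `y` is PENDANT (its only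
non-loop pair is `Py`) then (`Antithetic.Pendant.termTwo_pendant`)
  `TII(y, z; h) = ½ · Σ_{T : P ∈ X T, z ∉ Y T} h₁(X T ∪ {y} ∪ {x}) (Y T) · h₂(X T ∪ {y} ∪ {x}) (Y T)`,
i.e. TERM II at `(y, z)` over `E ∪ {Py}` is (half of) TERM II at `(P, z)` over `E` for the substituted test functions `g = h ∘ (x ↦ {y, x})`
(again odd and twisted-monotone) — the first step of THEOREM Θ (Δ2 for a handle on a cycle).  Proof: `y ∈ X⁺ T ⟺ Py ∈ T ∧ P ∈ X T`, then
`X⁺ T = X T ∪ {y}`, `Y⁺ T = Y T` (`Pendant.reachable_col_iff`, `reachable_col_leaf_iff`), and coordinate halving in `Py` (`DegTwo.sum_toggle`).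
[cite: VandenbergHaggstromKahn2005, §1 p. 3 (open cluster `C_s`)]
-/

noncomputable section

namespace Summit.CriticalPhenomena.PercolationContinuityZ3.Theorems

open Literature.Probability.Percolation
open scoped Classical symmDiff

namespace Antithetic

namespace Pendant

variable {V : Type*} [Fintype V] {E : Set (Sym2 V)} {s P y : V}

/-- **PR1 — pendant reduction of TERM II** (HOME/THEOREM-Theta.md §1): for a leaf `y` (meeting only loops of `E`) attached by the pair `Py`,
`P ≠ y`, `s ≠ y`, `z ≠ y`, TERM II at `(y,z)` over `E ∪ {Py}` equals half of TERM II at `(P,z)` over `E` with `x ↦ {y,x}` substituted. [this work] -/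
theorem termTwo_pendant (hy : ∀ f ∈ E, y ∈ f → f.IsDiag) (hPy : P ≠ y) (hsy : s ≠ y) {z : V} (hzy : z ≠ y) (x : V)
    (h₁ h₂ : Set V → Set V → ℝ) :
    ∑ T ∈ Finset.univ.filter (fun T : Set (Sym2 V) =>
        y ∈ openCluster (T ∩ insert s(P, y) E) s ∧ z ∉ openCluster (Tᶜ ∩ insert s(P, y) E) s),
      h₁ (openCluster (T ∩ insert s(P, y) E) s ∪ {x}) (openCluster (Tᶜ ∩ insert s(P, y) E) s) *
        h₂ (openCluster (T ∩ insert s(P, y) E) s ∪ {x}) (openCluster (Tᶜ ∩ insert s(P, y) E) s) =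
    (1 / 2 : ℝ) * ∑ T ∈ Finset.univ.filter (fun T : Set (Sym2 V) => P ∈ openCluster (T ∩ E) s ∧ z ∉ openCluster (Tᶜ ∩ E) s),
      h₁ (openCluster (T ∩ E) s ∪ {y} ∪ {x}) (openCluster (Tᶜ ∩ E) s) * h₂ (openCluster (T ∩ E) s ∪ {y} ∪ {x}) (openCluster (Tᶜ ∩ E) s) := by
  -- notation
  let Xp : Set (Sym2 V) → Set V := fun T => openCluster (T ∩ insert s(P, y) E) s
  let Yp : Set (Sym2 V) → Set V := fun T => openCluster (Tᶜ ∩ insert s(P, y) E) s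
  let X : Set (Sym2 V) → Set V := fun T => openCluster (T ∩ E) s
  let Y : Set (Sym2 V) → Set V := fun T => openCluster (Tᶜ ∩ E) s
  have he : s(P, y) ∉ E := pair_not_mem E P y hy hPy
  -- membership in the clusters of `E ∪ {Py}`
  have hXv : ∀ T (v : V), v ≠ y → (v ∈ Xp T ↔ v ∈ X T) := fun T v hv => reachable_col_iff hy hPy hsy T hv
  have hYv : ∀ T (v : V), v ≠ y → (v ∈ Yp T ↔ v ∈ Y T) := fun T v hv => reachable_col_iff hy hPy hsy Tᶜ hv
  have hXy : ∀ T, y ∈ Xp T ↔ s(P, y) ∈ T ∧ P ∈ X T := fun T => reachable_col_leaf_iff hy hPy hsy T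
  have hYy : ∀ T, y ∈ Yp T ↔ s(P, y) ∉ T ∧ P ∈ Y T := fun T => by
    show (openGraph (Tᶜ ∩ insert s(P, y) E)).Reachable s y ↔ _
    rw [reachable_col_leaf_iff hy hPy hsy Tᶜ]; rfl
  -- on the event, the clusters are `X T ∪ {y}` and `Y T`
  have hXeq : ∀ T, y ∈ Xp T → Xp T = X T ∪ {y} := by
    intro T hyT; ext v
    by_cases hv : v = y
    · rw [hv]; simp only [Set.mem_union, Set.mem_singleton_iff, or_true, iff_true]; exact hyT
    · rw [hXv T v hv, Set.mem_union, Set.mem_singleton_iff]; tauto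
  have hYeq : ∀ T, y ∈ Xp T → Yp T = Y T := by
    intro T hyT; ext v
    by_cases hv : v = y
    · rw [hv]
      have h1 : y ∉ Yp T := fun h => ((hYy T).1 h).1 ((hXy T).1 hyT).1
      have h2 : y ∉ Y T := not_reachable_leaf (Tᶜ ∩ E) y (fun f hf => hy f hf.2) hsy
      exact iff_of_false h1 h2
    · exact hYv T v hv
  -- Step 1: rewrite the left sum pointwise and re-express its filter
  have hL : ∑ T ∈ Finset.univ.filter (fun T : Set (Sym2 V) => y ∈ Xp T ∧ z ∉ Yp T), h₁ (Xp T ∪ {x}) (Yp T) * h₂ (Xp T ∪ {x}) (Yp T) =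
      ∑ T ∈ Finset.univ.filter (fun T : Set (Sym2 V) => s(P, y) ∈ T ∧ (P ∈ X T ∧ z ∉ Y T)),
        h₁ (X T ∪ {y} ∪ {x}) (Y T) * h₂ (X T ∪ {y} ∪ {x}) (Y T) := by
    have hfilt : Finset.univ.filter (fun T : Set (Sym2 V) => y ∈ Xp T ∧ z ∉ Yp T) =
        Finset.univ.filter (fun T : Set (Sym2 V) => s(P, y) ∈ T ∧ (P ∈ X T ∧ z ∉ Y T)) := by
      refine Finset.filter_congr fun T _ => ?_
      rw [hXy T, hYv T z hzy]; tauto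
    rw [hfilt]
    refine Finset.sum_congr rfl fun T hT => ?_
    have hT' := (Finset.mem_filter.1 hT).2
    have hyT : y ∈ Xp T := (hXy T).2 ⟨hT'.1, hT'.2.1⟩
    rw [hXeq T hyT, hYeq T hyT]
  -- Step 2: coordinate halving in the pair `Py` (the summand is blind to it)
  have hR : ∑ T ∈ Finset.univ.filter (fun T : Set (Sym2 V) => P ∈ X T ∧ z ∉ Y T),
      h₁ (X T ∪ {y} ∪ {x}) (Y T) * h₂ (X T ∪ {y} ∪ {x}) (Y T) =
      2 * ∑ T ∈ (Finset.univ.filter (fun T : Set (Sym2 V) => P ∈ X T ∧ z ∉ Y T)).filter (fun T => s(P, y) ∈ T),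
        h₁ (X T ∪ {y} ∪ {x}) (Y T) * h₂ (X T ∪ {y} ∪ {x}) (Y T) := by
    refine DegTwo.sum_toggle s(P, y) _ _ (fun T => ?_) (fun T => ?_)
    · simp only [Finset.mem_filter, Finset.mem_univ, true_and]
      show (P ∈ openCluster ((T ∆ {s(P, y)}) ∩ E) s ∧ z ∉ openCluster ((T ∆ {s(P, y)})ᶜ ∩ E) s) ↔ (P ∈ openCluster (T ∩ E) s ∧ z ∉ openCluster (Tᶜ ∩ E) s)
      rw [symmDiff_pair_inter he, compl_symmDiff_pair_inter he]
    · show h₁ (openCluster ((T ∆ {s(P, y)}) ∩ E) s ∪ {y} ∪ {x}) (openCluster ((T ∆ {s(P, y)})ᶜ ∩ E) s) *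
          h₂ (openCluster ((T ∆ {s(P, y)}) ∩ E) s ∪ {y} ∪ {x}) (openCluster ((T ∆ {s(P, y)})ᶜ ∩ E) s) =
        h₁ (X T ∪ {y} ∪ {x}) (Y T) * h₂ (X T ∪ {y} ∪ {x}) (Y T)
      rw [symmDiff_pair_inter he, compl_symmDiff_pair_inter he]
  have hff : (Finset.univ.filter (fun T : Set (Sym2 V) => P ∈ X T ∧ z ∉ Y T)).filter (fun T => s(P, y) ∈ T) =
      Finset.univ.filter (fun T : Set (Sym2 V) => s(P, y) ∈ T ∧ (P ∈ X T ∧ z ∉ Y T)) := by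
    rw [Finset.filter_filter]
    exact Finset.filter_congr fun T _ => by tauto
  show ∑ T ∈ Finset.univ.filter (fun T : Set (Sym2 V) => y ∈ Xp T ∧ z ∉ Yp T), h₁ (Xp T ∪ {x}) (Yp T) * h₂ (Xp T ∪ {x}) (Yp T) =
    (1 / 2 : ℝ) * ∑ T ∈ Finset.univ.filter (fun T : Set (Sym2 V) => P ∈ X T ∧ z ∉ Y T), h₁ (X T ∪ {y} ∪ {x}) (Y T) * h₂ (X T ∪ {y} ∪ {x}) (Y T)
  rw [hL, hR, hff]
  ring

end Pendant

end Antithetic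

end Summit.CriticalPhenomena.PercolationContinuityZ3.Theorems
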